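import Literature.MathematicalPhysics.QuantumFieldTheory.Balaban1983to89.B8Prop6CubeMemberScalarGammaHoldsG
import Literature.MathematicalPhysics.QuantumFieldTheory.Balaban1983to89.B8SpecialLinearTrace
import Literature.MathematicalPhysics.QuantumFieldTheory.Balaban1983to89.B7AvgClosedSpecialUnitarySharp

/-!
# `Balaban1983to89.B8Prop6CubeMemberScalarGammaHoldsSU` — [Balaban1985RegularSpaces] PROPOSITION 6 (p. 99), (1.135)–(1.138), AT EVERY CUBE OF PRINT'S BIG-BLOCK
# SUB-LATTICE FOR `G = SU(N)` ([Balaban1985Averaging] p. 20 «We consider a Lie subgroup G of a unitary group U(N)»; `SU(N)` the case of record): the `G`-crown of `B8Prop6CubeMemberScalarGammaHoldsG` AT `𝔸 = M_N(ℂ)`, `G = SU(N)`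
# (`N ≤ 25`), `H = SL(N, ℂ)`, `τ = tr` — THE GAUGE TRANSFORMATION `u` IS SPECIAL UNITARY

statement-level skeleton of published theorems with citation tags; proofs where landed; nothing here is a claim about the Yang–Mills mass gap

T. Bałaban, *Spaces of regular gauge field configurations on a lattice and gauge fixing conditions*, Commun. Math. Phys. **99** (1985) 75–102
`[Balaban1985RegularSpaces]` ("B8"): Prop. 6 (1.135)–(1.138) p. 99, p. 98, p. 76 («R(U)X = UXU⁻¹ for a unitary matrix U»); [Balaban1985Averaging] p. 20 («We consider a Lie subgroup G of a unitary group U(N)»); T. Bałaban, *Averaging operations for lattice gauge theories*,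
CMP **98** (1985) 17–51 `[Balaban1985Averaging]` p. 20, (20)–(23) p. 21, (42)–(43) pp. 23–24.  STATUS: published, refereed.

CITATION HEADER (lean-in-tree rule).  Cell `pub-ymgap` (HUMAN RULING D-0062, Track A), DAG node N05 = [B8], seat `pub-ymgap-dag-n05-e` g33 (Prop-6 γ-crown authoring lineage),
CROSS-CELL SERVICE for cell `ym3-torus` (LEAD-H ★ym-ust-19200-w5 g6, line H-P6J of crux stmt-QuantumFields-19200, rung R3 = YM₃ on T³; pub-ymgap bus XCELL-1∕2∕3,
INTENT-G1): companion (F9) of the `G`-valued re-run F1–F8.  WHAT IS CERTIFIED.  ★★★ `gaugedBoundB8_cubeMember_scalar_γ_holds_L3_specialUnitary` (`d ≥ 2`, odd `L ≥ 3`,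
`N ≤ 25`) and ★★★ `gaugedBoundB8_cubeMember_scalar_γ_holds_specialUnitary` (odd `L ≥ 5`): (F8)'s `gaugedBoundB8_cubeMember_scalar_γ_holds(_L3)_mem` with the joint J-SU data
INHABITED by ym3-torus's lemmas — `τ := B8SpecialUnitaryTrace.trCLM` (tracial: `trCLM_mul_comm`), `G := specialUnitaryUnits (Fin N)`, `H := B13Inv214OrbitSUN.slUnits N`, (H2)
`B8SpecialLinearTrace.trCLM_mlog_eq_zero_of_mem_slUnits` (`N ≤ 25`), (H3) `expUnit_mem_slUnits`, `specialUnitaryUnits_le_slUnits`, `specialUnitaryUnits_le_unitaryUnits`,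
`B7AvgClosedSpecialUnitarySharp.avgClosed_specialUnitary_of_le` (`SU(N)` averaging-closed, `N ≤ 25`), `B8SpecialUnitaryTrace.gaugeExp_mem_specialUnitaryUnits`.  One `exact`
each.  Kind «kernel-checked proof», theorems only: no `def`, no `… : Prop` fact, no `instance` (the `CStarAlgebra (Matrix …)` structure is a `letI` inside statement and
proof, as in ym3-torus's files), no `notation`, no existing module modified.  `--supports stmt-QuantumFields-19200` (ym3-torus's crux; count-neutral for both cells).

HONEST SCOPE.  Instantiation only; the analytic content is that of the unitary crown plus ym3-torus's trace-free Proposition-5 bodies (see F8's header); NO new estimate;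
N05's Track-A status (DISCHARGED OF RECORD, director-ym №237) untouched — NOT a pub-ymgap discharge; rung R3 is ym3-torus's and NOT the Clay problem; nothing of
`stub_halvingStep` ∕ crux 19200 claimed; nothing continuum ∕ ℝ⁴ ∕ OS ∕ mass-gap ∕ Clay.  No `sorry`, no `def`.
-/

noncomputable section

namespace Literature.MathematicalPhysics.QuantumFieldTheory.Balaban1983to89.B8Prop6CubeMemberScalarGammaHoldsSU

open scoped Matrix
open MatrixLog B7Prop1Explicit B7Prop2Explicit B7Prop1Local B7Eq92Concrete
open B8Eq184Proof (gaugeExp cfgExp)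
open B8Eq119TwistedAxial (Restr129)
open B8Eq138LandauZd (IsLandau138W logCfg covLap)
open B8Eq131Cubes (tLo tHi bLo bHi)
open B8Ineq130 (tlo thi)
open B8Eq140Level (SideTouches)
open B8Ineq132 (covDerivFwd InAk)
open B8Eq143PlaqExpansion (pdiv)
open B8Eq146AExpansion (iEta plaqCovDeriv)
open B8ScaledSupNorm (bondNorm msup)
open B7Prop4GeneralLevels (logCovIter)
open MatrixLog (mlog)
open NormedSpace
open Node00 (CubeB8 GaugedBoundB8)
open B8Prop6CubeMemberScalarGammaHoldsG (gaugedBoundB8_cubeMember_scalar_γ_holds_mem gaugedBoundB8_cubeMember_scalar_γ_holds_L3_mem)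

export B7Prop1Explicit (Site)

variable {d : ℕ}

/-! ## §1  AT `𝔸 = M_N(ℂ)`, `G = SU(N)` (`N ≤ 25`), `H = SL(N, ℂ)`, `τ = tr`: PROPOSITION 6 WITH A SPECIAL-UNITARY GAUGE TRANSFORMATION ([Balaban1985Averaging] p. 20's setting at `G = SU(N)`) -/

section SpecialUnitary

open scoped Matrix.Norms.L2Operator
open B7Prop2SpecialUnitary (specialUnitaryUnits specialUnitaryUnits_le_unitaryUnits)
open B13Inv214OrbitSUN (slUnits)
open B8SpecialUnitaryTrace (trCLM trCLM_mul_comm gaugeExp_mem_specialUnitaryUnits)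
open B8SpecialLinearTrace (specialUnitaryUnits_le_slUnits trCLM_mlog_eq_zero_of_mem_slUnits expUnit_mem_slUnits)
open B7AvgClosedSpecialUnitarySharp (avgClosed_specialUnitary_of_le)

/-- ★★★ **PROPOSITION 6 (p. 99) AT EVERY CUBE OF PRINT'S BIG-BLOCK SUB-LATTICE WITH A SPECIAL-UNITARY GAUGE TRANSFORMATION — `G = SU(N)` ([Balaban1985Averaging] p. 20's Lie subgroup `G ≤ U(N)`, the case of record), `d ≥ 2`,
odd `L ≥ 3`, `N ≤ 25`**: `B8Prop6CubeMemberScalarGammaHoldsG`'s `G`-crown (§4 ∕ §3) at `𝔸 := M_N(ℂ)`, `τ := tr` (`B8SpecialUnitaryTrace.trCLM`), `G := SU(N)` (`B7Prop2SpecialUnitary.specialUnitaryUnits`), `H := SL(N, ℂ)`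
(`B13Inv214OrbitSUN.slUnits`), the joint J-SU data inhabited by ym3-torus's `B8SpecialLinearTrace` ((H2) `trCLM_mlog_eq_zero_of_mem_slUnits`, (H3) `expUnit_mem_slUnits`,
`specialUnitaryUnits_le_slUnits`), `B7AvgClosedSpecialUnitarySharp.avgClosed_specialUnitary_of_le` (`SU(N)` averaging-closed, `N ≤ 25`) and `B8SpecialUnitaryTrace.
gaugeExp_mem_specialUnitaryUnits` (`e^{iλ} ∈ SU(N)` for Hermitian trace-free `λ`): for every `SU(N)`-valued `U₀ ∈ 𝔄_K(α₀)` at a cube of the sub-lattice, the gauge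
transformation `u` of (1.135)–(1.138) and `v⁻¹u` are `SU(N)`-VALUED.  (`Node00.GaugedBoundB8` follows by `B8Prop6CubeMemberScalarGammaHoldsG.gaugedBoundB8_of_body_mem` with `specialUnitaryUnits_le_unitaryUnits`.)
[cite: Balaban1985RegularSpaces, Prop. 6 (1.135)–(1.138) p.99, p.98, p.76; Balaban1985Averaging, p.18, p.20, (42)–(43) pp.23–24] -/
theorem gaugedBoundB8_cubeMember_scalar_γ_holds_L3_specialUnitary (hd2 : 2 ≤ d) {L : ℕ} (hL3 : 3 ≤ L) (hodd : Odd L) {N : ℕ} [NeZero N] (hN : N ≤ 25) :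
    letI : CStarAlgebra (Matrix (Fin N) (Fin N) ℂ) := {}
    ∃ B₀ c₁ ρ₀ M₀ : ℝ, ∃ N₀ R₀ : ℕ, 1 ≤ B₀ ∧ 0 < c₁ ∧ ∀ (η : ℝ), 0 < η → ∀ {K : ℕ} {Ω : ℕ → Set (Site d)} (c : CubeB8 d L K Ω),
      ∀ (s R : ℕ), 3 ≤ L ^ s → M₀ ≤ (L : ℝ) ^ (s + 1) → L ^ (s + 1) ∣ c.ρ → L ^ (s + 1) ∣ c.M → R * L ^ (s + 1) ≤ c.ρ → 2 * L ≤ R →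
        R₀ ≤ R → N₀ + 1 ≤ R * L ^ (s + 1) → ρ₀ ≤ (c.ρ : ℝ) →
      ∀ (U₀ : Site d → Fin d → (Matrix (Fin N) (Fin N) ℂ)ˣ), (∀ x κ, U₀ x κ ∈ specialUnitaryUnits (Fin N)) → ∀ (α₀ : ℝ), 0 < α₀ → InAk L K η α₀ Ω U₀ →
      7 * d * (L : ℝ) ^ 2 * c.M * α₀ ≤ c₁ →
      ∃ u : Site d → (Matrix (Fin N) (Fin N) ℂ)ˣ, (∀ x, u x ∈ specialUnitaryUnits (Fin N)) ∧ (∀ x, x ∉ c.sq 0 → u x = 1) ∧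
        Restr129 L c.k c.lamS (1 : Site d → Fin d → (Matrix (Fin N) (Fin N) ℂ)ˣ) u ∧
        IsLandau138W L c.k η (c.sq 0) c.lamS (1 : Site d → Fin d → (Matrix (Fin N) (Fin N) ℂ)ˣ) (c.fixed U₀ u) ∧
        (∀ j, j ≤ c.k → ∀ b ∈ {b : Site d × Fin d | SideTouches (c.sq j) b.1 b.2},
          c.fixed U₀ u b.1 b.2 = cfgExp η (logCfg η (c.fixed U₀ u)) b.1 b.2 ∧ IsSelfAdjoint (logCfg η (c.fixed U₀ u) b.1 b.2) ∧
            ‖logCfg η (c.fixed U₀ u) b.1 b.2‖ ≤ (7 * d * (L : ℝ) ^ 2 * (5 * (d : ℝ) * L * B₀) * c.M * α₀) * ((L : ℝ) ^ j * η)⁻¹) ∧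
        (∀ x, ((c.vfix U₀)⁻¹ * u) x ∈ specialUnitaryUnits (Fin N)) ∧
        AgreeOn (tlo L (tLo c.a c.ρ) c.k) (thi L (tHi c.a c.M c.ρ) c.k) (gaugeAct ((c.vfix U₀)⁻¹ * u)⁻¹ U₀) (c.fixed U₀ u) ∧
        msup L c.k η (-(2 : ℝ)) (fun j (t : Fin d × Fin d × Site d) => SideTouches (c.sq j) t.2.2 t.2.1)
            (fun t => covDerivFwd η (1 : Site d → Fin d → (Matrix (Fin N) (Fin N) ℂ)ˣ) t.1 (fun z => c.expo η U₀ u z t.2.1) t.2.2) ≤ (7 * d * (L : ℝ) ^ 2 * (5 * (d : ℝ) * L * B₀) * c.M * α₀) ∧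
        bondNorm L c.k η (-(3 : ℝ)) c.sq
            (fun x μ => pdiv η (1 : Site d → Fin d → (Matrix (Fin N) (Fin N) ℂ)ˣ) (plaqCovDeriv η (1 : Site d → Fin d → (Matrix (Fin N) (Fin N) ℂ)ˣ) (c.expo η U₀ u)) μ x) ≤ (7 * d * (L : ℝ) ^ 2 * (5 * (d : ℝ) * L * B₀) * c.M * α₀) ∧
        bondNorm L c.k η (-(3 : ℝ)) c.sq (fun x μ => covLap η (1 : Site d → Fin d → (Matrix (Fin N) (Fin N) ℂ)ˣ) (fun z => c.expo η U₀ u z μ) x) ≤ (7 * d * (L : ℝ) ^ 2 * (5 * (d : ℝ) * L * B₀) * c.M * α₀) ∧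
        (∀ (x : Site d) (μ : Fin d), bLo L c.a 0 0 ≤ x → x + e μ ≤ bHi L c.a c.M 0 0 →
          logCovIter L (1 : Site d → Fin d → (Matrix (Fin N) (Fin N) ℂ)ˣ) (iEta η (c.expo η U₀ u)) c.k x μ = mlog ((avgIter L (c.axial U₀) c.k x μ : (Matrix (Fin N) (Fin N) ℂ)ˣ) : Matrix (Fin N) (Fin N) ℂ)) := by
  letI : CStarAlgebra (Matrix (Fin N) (Fin N) ℂ) := {}
  exact gaugedBoundB8_cubeMember_scalar_γ_holds_L3_mem (𝔸 := Matrix (Fin N) (Fin N) ℂ) (trCLM (Fin N)) trCLM_mul_comm hd2 hL3 hodd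
    (G := specialUnitaryUnits (Fin N)) (H := slUnits N)
    (fun g hg hs => trCLM_mlog_eq_zero_of_mem_slUnits hN hg hs) (fun S hS => expUnit_mem_slUnits hS)
    (avgClosed_specialUnitary_of_le hN d L) specialUnitaryUnits_le_slUnits specialUnitaryUnits_le_unitaryUnits
    (fun lam hsa htr x => gaugeExp_mem_specialUnitaryUnits hsa htr x)

/-- ★★★ The same for odd `L ≥ 5` through `gaugedBoundB8_cubeMember_scalar_γ_holds_mem` (dag-n05-c's `L ≥ 5` transplant). [cite: Balaban1985RegularSpaces, Prop. 6 (1.135)–(1.138) p.99, p.76; Balaban1985Averaging, p.20] -/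
theorem gaugedBoundB8_cubeMember_scalar_γ_holds_specialUnitary (hd2 : 2 ≤ d) {L : ℕ} (hL5 : 5 ≤ L) (hodd : Odd L) {N : ℕ} [NeZero N] (hN : N ≤ 25) :
    letI : CStarAlgebra (Matrix (Fin N) (Fin N) ℂ) := {}
    ∃ B₀ c₁ ρ₀ M₀ : ℝ, ∃ N₀ R₀ : ℕ, 1 ≤ B₀ ∧ 0 < c₁ ∧ ∀ (η : ℝ), 0 < η → ∀ {K : ℕ} {Ω : ℕ → Set (Site d)} (c : CubeB8 d L K Ω),
      ∀ (s R : ℕ), 3 ≤ L ^ s → M₀ ≤ (L : ℝ) ^ (s + 1) → L ^ (s + 1) ∣ c.ρ → L ^ (s + 1) ∣ c.M → R * L ^ (s + 1) ≤ c.ρ → 2 * L ≤ R →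
        R₀ ≤ R → N₀ + 1 ≤ R * L ^ (s + 1) → ρ₀ ≤ (c.ρ : ℝ) →
      ∀ (U₀ : Site d → Fin d → (Matrix (Fin N) (Fin N) ℂ)ˣ), (∀ x κ, U₀ x κ ∈ specialUnitaryUnits (Fin N)) → ∀ (α₀ : ℝ), 0 < α₀ → InAk L K η α₀ Ω U₀ →
      7 * d * (L : ℝ) ^ 2 * c.M * α₀ ≤ c₁ →
      ∃ u : Site d → (Matrix (Fin N) (Fin N) ℂ)ˣ, (∀ x, u x ∈ specialUnitaryUnits (Fin N)) ∧ (∀ x, x ∉ c.sq 0 → u x = 1) ∧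
        Restr129 L c.k c.lamS (1 : Site d → Fin d → (Matrix (Fin N) (Fin N) ℂ)ˣ) u ∧
        IsLandau138W L c.k η (c.sq 0) c.lamS (1 : Site d → Fin d → (Matrix (Fin N) (Fin N) ℂ)ˣ) (c.fixed U₀ u) ∧
        (∀ j, j ≤ c.k → ∀ b ∈ {b : Site d × Fin d | SideTouches (c.sq j) b.1 b.2},
          c.fixed U₀ u b.1 b.2 = cfgExp η (logCfg η (c.fixed U₀ u)) b.1 b.2 ∧ IsSelfAdjoint (logCfg η (c.fixed U₀ u) b.1 b.2) ∧
            ‖logCfg η (c.fixed U₀ u) b.1 b.2‖ ≤ (7 * d * (L : ℝ) ^ 2 * (5 * (d : ℝ) * L * B₀) * c.M * α₀) * ((L : ℝ) ^ j * η)⁻¹) ∧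
        (∀ x, ((c.vfix U₀)⁻¹ * u) x ∈ specialUnitaryUnits (Fin N)) ∧
        AgreeOn (tlo L (tLo c.a c.ρ) c.k) (thi L (tHi c.a c.M c.ρ) c.k) (gaugeAct ((c.vfix U₀)⁻¹ * u)⁻¹ U₀) (c.fixed U₀ u) ∧
        msup L c.k η (-(2 : ℝ)) (fun j (t : Fin d × Fin d × Site d) => SideTouches (c.sq j) t.2.2 t.2.1)
            (fun t => covDerivFwd η (1 : Site d → Fin d → (Matrix (Fin N) (Fin N) ℂ)ˣ) t.1 (fun z => c.expo η U₀ u z t.2.1) t.2.2) ≤ (7 * d * (L : ℝ) ^ 2 * (5 * (d : ℝ) * L * B₀) * c.M * α₀) ∧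
        bondNorm L c.k η (-(3 : ℝ)) c.sq
            (fun x μ => pdiv η (1 : Site d → Fin d → (Matrix (Fin N) (Fin N) ℂ)ˣ) (plaqCovDeriv η (1 : Site d → Fin d → (Matrix (Fin N) (Fin N) ℂ)ˣ) (c.expo η U₀ u)) μ x) ≤ (7 * d * (L : ℝ) ^ 2 * (5 * (d : ℝ) * L * B₀) * c.M * α₀) ∧
        bondNorm L c.k η (-(3 : ℝ)) c.sq (fun x μ => covLap η (1 : Site d → Fin d → (Matrix (Fin N) (Fin N) ℂ)ˣ) (fun z => c.expo η U₀ u z μ) x) ≤ (7 * d * (L : ℝ) ^ 2 * (5 * (d : ℝ) * L * B₀) * c.M * α₀) ∧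
        (∀ (x : Site d) (μ : Fin d), bLo L c.a 0 0 ≤ x → x + e μ ≤ bHi L c.a c.M 0 0 →
          logCovIter L (1 : Site d → Fin d → (Matrix (Fin N) (Fin N) ℂ)ˣ) (iEta η (c.expo η U₀ u)) c.k x μ = mlog ((avgIter L (c.axial U₀) c.k x μ : (Matrix (Fin N) (Fin N) ℂ)ˣ) : Matrix (Fin N) (Fin N) ℂ)) := by
  letI : CStarAlgebra (Matrix (Fin N) (Fin N) ℂ) := {}
  exact gaugedBoundB8_cubeMember_scalar_γ_holds_mem (𝔸 := Matrix (Fin N) (Fin N) ℂ) (trCLM (Fin N)) trCLM_mul_comm hd2 hL5 hodd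
    (G := specialUnitaryUnits (Fin N)) (H := slUnits N)
    (fun g hg hs => trCLM_mlog_eq_zero_of_mem_slUnits hN hg hs) (fun S hS => expUnit_mem_slUnits hS)
    (avgClosed_specialUnitary_of_le hN d L) specialUnitaryUnits_le_slUnits specialUnitaryUnits_le_unitaryUnits
    (fun lam hsa htr x => gaugeExp_mem_specialUnitaryUnits hsa htr x)

#print axioms gaugedBoundB8_cubeMember_scalar_γ_holds_L3_specialUnitary
#print axioms gaugedBoundB8_cubeMember_scalar_γ_holds_specialUnitary

end SpecialUnitary

end Literature.MathematicalPhysics.QuantumFieldTheory.Balaban1983to89.B8Prop6CubeMemberScalarGammaHoldsSU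

end
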